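import Mathlib
import Summits.NavierStokesRegularity.NavierStokesRegularity.Theorems.WakeRatchetTailRatchetRelayKernel
import Summits.NavierStokesRegularity.NavierStokesRegularity.Theorems.WakeRatchetTailRatchetRelayGreen
import HarnessLib

/-!
# `WakeRatchet.TailRatchet` (stmt-NavierStokesRegularity-21808): SOLVABILITY of the linearised drain-free
# front equation — the backward inhomogeneous pantograph problem `h' = 2e^{t/2}h(t/2) + f`, `h(0) = 0`,
# has a unique solution on `(−∞,0]` (Banach fixed point)

Support file for the crux `TailRatchet` (route `WakeRatchet`; MODEL lattice ODEs of Tao 2016 §1.2, §4 —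
nothing in this file is a statement about the Navier–Stokes equations, and no item is closed here).

Context (files `…RelayProfile` / `…RelayAdjoint` / `…RelayTransversality` / `…RelayKernel` / `…RelayGreen`
/ `…RelayMoments`; census of stmt-21808, programme "R-lac", step R-lac-2): to invert the bordered
linearisation `(h,σ) ↦ L₀h + σ(1+t/2)e^{t}`, `L₀h = h' − 2e^{t/2}h(t/2)`, of the normalised drain-free scalar
front equation of the construction item `DyadicScalarFronts` at the relay profile, one must SOLVE the
inhomogeneous linear problem `L₀h = f` backward from `0⁻`.  Read from `0⁻` towards `−∞` the argument `t/2`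
is retarded, and in the variable `u(t) = e^{t}h(t)` the problem is the fixed-point equation
`u(t) = e^{t}∫_0^{t}(2u(s/2) + f(s)) ds` (`t ≤ 0`), whose right-hand side is a CONTRACTION of the space of
bounded continuous functions with constant `2/e < 1` (`|t|e^{t} ≤ 1/e`).  This file proves, sorry-free:

* `mul_exp_neg_le_exp_neg_one` — `x e^{−x} ≤ e^{−1}` for `x ≥ 0`; `two_div_exp_one_lt_one` — `2/e < 1`;
* `pantograph_inhom_exists` — **EXISTENCE**: for `f` continuous and bounded on `(−∞,0]` there is `h`,
  continuous on `ℝ`, with `h(0) = 0`, `h'(t) = 2e^{t/2}h(t/2) + f(t)` for every `t < 0`, and the a-priori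
  growth bound `|h(t)| ≤ C e^{−t}` on `t ≤ 0` (constructed as `h(t) = ∫_0^t (2u⋆(s/2) + f)`, `u⋆` the Banach
  fixed point in `ℝ →ᵇ ℝ`);
* `pantograph_inhom_unique` — **UNIQUENESS** among functions continuous on `(−∞,0]` with the same value at
  `0` (by `WakeRatchetRelayKernel.pantograph_eq_zero`).

Remaining for R-lac-2 (census): boundedness of `h` when `f` is integrable, the limit `h(−∞) = −∫w₁f`
(then immediate from `WakeRatchetRelayGreen.adjoint_green`), and the decay rate `h ∈ X_γ` when `∫w₁f = 0`;
then R-lac-3/4 (the `C¹` setting and the implicit function theorem).  Fronts for lacunary `Λ` do NOT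
refute `TailRatchet` (which needs `Λ → 1`).

HONEST FRAMING: elementary real analysis; MODEL lattice only; the construction item and the crux stay open.
-/

noncomputable section

set_option linter.dupNamespace false

namespace Summit.NavierStokesRegularity.NavierStokesRegularity.Theorems

namespace WakeRatchetRelaySolvability

open MeasureTheory Set Filter Topology Real intervalIntegral
open scoped BoundedContinuousFunction
open WakeRatchetRelayKernel

/-! ## Two numerical facts -/

/-- `x e^{−x} ≤ e^{−1}` for every real `x` (from `x ≤ e^{x−1}`). [folklore] -/
theorem mul_exp_neg_le_exp_neg_one (x : ℝ) : x * Real.exp (-x) ≤ Real.exp (-1) := by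
  have h1 : x - 1 + 1 ≤ Real.exp (x - 1) := Real.add_one_le_exp _
  have h2 : x ≤ Real.exp (x - 1) := by linarith
  have h3 : Real.exp (x - 1) * Real.exp (-x) = Real.exp (-1) := by
    rw [← Real.exp_add]; ring_nf
  calc x * Real.exp (-x) ≤ Real.exp (x - 1) * Real.exp (-x) :=
        mul_le_mul_of_nonneg_right h2 (Real.exp_pos _).le
    _ = Real.exp (-1) := h3

/-- `|t| e^{t} ≤ e^{−1}` for `t ≤ 0`. [folklore] -/
theorem abs_mul_exp_le_exp_neg_one {t : ℝ} (ht : t ≤ 0) : |t| * Real.exp t ≤ Real.exp (-1) := by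
  have := mul_exp_neg_le_exp_neg_one (-t)
  rwa [neg_neg, ← abs_of_nonpos ht] at this

/-- `2/e < 1`. [folklore] -/
theorem two_div_exp_one_lt_one : 2 / Real.exp 1 < 1 := by
  have h := Real.exp_one_gt_d9
  rw [div_lt_one (Real.exp_pos 1)]
  linarith

/-! ## The fixed-point operator, pointwise -/

variable {f : ℝ → ℝ} {A : ℝ}

/-- The operator `(Tu)(t) = e^{t'}∫_0^{t'}(2u(s/2) + f(s)) ds`, `t' = min t 0`, is continuous in `t`.
[folklore] -/
theorem op_continuous (hf : Continuous f) (u : ℝ →ᵇ ℝ) :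
    Continuous (fun t : ℝ => Real.exp (min t 0) *
      ∫ s in (0 : ℝ)..min t 0, (2 * u (s / 2) + f s)) := by
  have hG : Continuous (fun s : ℝ => 2 * u (s / 2) + f s) :=
    (continuous_const.mul (u.continuous.comp (continuous_id.div_const 2))).add hf
  have hmin : Continuous (fun t : ℝ => min t 0) := continuous_id.min continuous_const
  exact (Real.continuous_exp.comp hmin).mul
    ((intervalIntegral.continuous_primitive (fun a b => hG.intervalIntegrable a b) 0).comp hmin)

/-- Pointwise bound: `|(Tu)(t)| ≤ 2‖u‖ + A` when `|f| ≤ A` on `(−∞,0]`. [folklore] -/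
theorem op_abs_le (hA : ∀ s : ℝ, s ≤ 0 → |f s| ≤ A) (u : ℝ →ᵇ ℝ) (t : ℝ) :
    |Real.exp (min t 0) * ∫ s in (0 : ℝ)..min t 0, (2 * u (s / 2) + f s)| ≤ 2 * ‖u‖ + A := by
  have hA0 : 0 ≤ A := (abs_nonneg _).trans (hA 0 le_rfl)
  set t' := min t 0 with ht'
  have ht'0 : t' ≤ 0 := min_le_right _ _
  have hint : ‖∫ s in (0 : ℝ)..t', (2 * u (s / 2) + f s)‖ ≤ (2 * ‖u‖ + A) * |t' - 0| := by
    refine intervalIntegral.norm_integral_le_of_norm_le_const fun s hs => ?_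
    have hs0 : s ≤ 0 := by
      rcases hs with ⟨h1, h2⟩
      have : max 0 t' = 0 := max_eq_left ht'0
      rw [this] at h2; exact h2
    rw [Real.norm_eq_abs]
    calc |2 * u (s / 2) + f s| ≤ |2 * u (s / 2)| + |f s| := abs_add_le _ _
      _ = 2 * |u (s / 2)| + |f s| := by rw [abs_mul, abs_two]
      _ ≤ 2 * ‖u‖ + A := add_le_add (mul_le_mul_of_nonneg_left
          (by rw [← Real.norm_eq_abs]; exact u.norm_coe_le_norm _) (by norm_num)) (hA s hs0)
  rw [sub_zero] at hint
  have hexp : |t'| * Real.exp t' ≤ 1 := by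
    have := abs_mul_exp_le_exp_neg_one ht'0
    have h1 : Real.exp (-1) ≤ 1 := Real.exp_le_one_iff.2 (by norm_num)
    linarith
  rw [abs_mul, abs_of_pos (Real.exp_pos _), ← Real.norm_eq_abs]
  calc Real.exp t' * ‖∫ s in (0 : ℝ)..t', (2 * u (s / 2) + f s)‖
      ≤ Real.exp t' * ((2 * ‖u‖ + A) * |t'|) := mul_le_mul_of_nonneg_left hint (Real.exp_pos _).le
    _ = (2 * ‖u‖ + A) * (|t'| * Real.exp t') := by ring
    _ ≤ (2 * ‖u‖ + A) * 1 := mul_le_mul_of_nonneg_left hexp (by positivity)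
    _ = 2 * ‖u‖ + A := mul_one _

/-- Pointwise Lipschitz bound: `|(Tu)(t) − (Tv)(t)| ≤ (2/e)·dist(u,v)`. [folklore] -/
theorem op_sub_abs_le (hf : Continuous f) (u v : ℝ →ᵇ ℝ) (t : ℝ) :
    |Real.exp (min t 0) * (∫ s in (0 : ℝ)..min t 0, (2 * u (s / 2) + f s)) -
      Real.exp (min t 0) * (∫ s in (0 : ℝ)..min t 0, (2 * v (s / 2) + f s))| ≤
      2 / Real.exp 1 * dist u v := by
  set t' := min t 0 with ht'
  have ht'0 : t' ≤ 0 := min_le_right _ _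
  have hcu : Continuous (fun s : ℝ => 2 * u (s / 2) + f s) :=
    (continuous_const.mul (u.continuous.comp (continuous_id.div_const 2))).add hf
  have hcv : Continuous (fun s : ℝ => 2 * v (s / 2) + f s) :=
    (continuous_const.mul (v.continuous.comp (continuous_id.div_const 2))).add hf
  have hdiff : Real.exp t' * (∫ s in (0 : ℝ)..t', (2 * u (s / 2) + f s)) -
      Real.exp t' * (∫ s in (0 : ℝ)..t', (2 * v (s / 2) + f s)) =
      Real.exp t' * (2 * ∫ s in (0 : ℝ)..t', (u (s / 2) - v (s / 2))) := by
    have hfg : (fun s : ℝ => 2 * u (s / 2) + f s - (2 * v (s / 2) + f s)) =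
        fun s : ℝ => 2 * (u (s / 2) - v (s / 2)) := by
      funext s; ring
    rw [← mul_sub, ← intervalIntegral.integral_sub (hcu.intervalIntegrable _ _) (hcv.intervalIntegrable _ _),
      hfg, intervalIntegral.integral_const_mul]
  rw [hdiff, abs_mul, abs_mul, abs_of_pos (Real.exp_pos _), abs_two]
  have hb : ‖∫ s in (0 : ℝ)..t', (u (s / 2) - v (s / 2))‖ ≤ dist u v * |t' - 0| := by
    refine intervalIntegral.norm_integral_le_of_norm_le_const fun s _ => ?_
    rw [← dist_eq_norm]; exact u.dist_coe_le_dist _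
  rw [sub_zero, Real.norm_eq_abs] at hb
  have hexp := abs_mul_exp_le_exp_neg_one ht'0
  have he1 : Real.exp (-1) = 1 / Real.exp 1 := by rw [Real.exp_neg, one_div]
  calc Real.exp t' * (2 * |∫ s in (0 : ℝ)..t', (u (s / 2) - v (s / 2))|)
      ≤ Real.exp t' * (2 * (dist u v * |t'|)) :=
        mul_le_mul_of_nonneg_left (mul_le_mul_of_nonneg_left hb (by norm_num)) (Real.exp_pos _).le
    _ = 2 * dist u v * (|t'| * Real.exp t') := by ring
    _ ≤ 2 * dist u v * Real.exp (-1) := mul_le_mul_of_nonneg_left hexp (by positivity)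
    _ = 2 / Real.exp 1 * dist u v := by rw [he1]; ring

/-! ## Existence by the Banach fixed-point theorem, and uniqueness -/

/-- **EXISTENCE for the backward inhomogeneous pantograph problem.**  Let `f` be continuous with
`|f| ≤ A` on `(−∞,0]`.  Then there is `h : ℝ → ℝ`, continuous, with `h(0) = 0`,
`h'(t) = 2e^{t/2}h(t/2) + f(t)` for every `t < 0`, and `|h(t)| ≤ C e^{−t}` on `t ≤ 0`.
(Construction: `u⋆ ∈ ℝ →ᵇ ℝ` the fixed point of the `2/e`-contraction
`(Tu)(t) = e^{t'}∫_0^{t'}(2u(s/2)+f)`, `t' = min t 0`; `h(t) = ∫_0^t (2u⋆(s/2) + f(s)) ds`.)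
[cite: Tao2016AveragedNS, §1.2 (dyadic model); cell vocabulary (linearised scalar front equation of `DyadicScalarFronts` at the relay profile, drain dropped; programme R-lac, step R-lac-2)] -/
theorem pantograph_inhom_exists (hf : Continuous f) (hA : ∀ s : ℝ, s ≤ 0 → |f s| ≤ A) :
    ∃ h : ℝ → ℝ, Continuous h ∧ h 0 = 0 ∧
      (∀ t : ℝ, t < 0 → HasDerivAt h (2 * Real.exp (t / 2) * h (t / 2) + f t) t) ∧
      ∃ C : ℝ, ∀ t : ℝ, t ≤ 0 → |h t| ≤ C * Real.exp (-t) := by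
  have hA0 : 0 ≤ A := (abs_nonneg _).trans (hA 0 le_rfl)
  -- the operator on bounded continuous functions
  let T : (ℝ →ᵇ ℝ) → (ℝ →ᵇ ℝ) := fun u =>
    BoundedContinuousFunction.mkOfBound
      ⟨fun t : ℝ => Real.exp (min t 0) * ∫ s in (0 : ℝ)..min t 0, (2 * u (s / 2) + f s),
        op_continuous hf u⟩ (2 * (2 * ‖u‖ + A)) (fun x y => by
          rw [Real.dist_eq]
          have hx := op_abs_le hA u x
          have hy := op_abs_le hA u y
          calc |Real.exp (min x 0) * (∫ s in (0 : ℝ)..min x 0, (2 * u (s / 2) + f s)) -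
                Real.exp (min y 0) * (∫ s in (0 : ℝ)..min y 0, (2 * u (s / 2) + f s))|
              ≤ |Real.exp (min x 0) * ∫ s in (0 : ℝ)..min x 0, (2 * u (s / 2) + f s)| +
                |Real.exp (min y 0) * ∫ s in (0 : ℝ)..min y 0, (2 * u (s / 2) + f s)| := abs_sub _ _
            _ ≤ 2 * (2 * ‖u‖ + A) := by linarith)
  have hT_apply : ∀ (u : ℝ →ᵇ ℝ) (t : ℝ),
      T u t = Real.exp (min t 0) * ∫ s in (0 : ℝ)..min t 0, (2 * u (s / 2) + f s) := fun u t => rfl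
  -- contraction with constant `2/e`
  set K : NNReal := ⟨2 / Real.exp 1, by positivity⟩ with hK
  have hKval : (K : ℝ) = 2 / Real.exp 1 := rfl
  have hcontr : ContractingWith K T := by
    refine ⟨?_, LipschitzWith.of_dist_le_mul fun u v => ?_⟩
    · change (K : ℝ) < 1
      rw [hKval]; exact two_div_exp_one_lt_one
    · rw [hKval]
      refine (BoundedContinuousFunction.dist_le (by positivity)).2 fun t => ?_
      rw [Real.dist_eq, hT_apply, hT_apply]
      exact op_sub_abs_le hf u v t
  -- the fixed point
  set ustar := ContractingWith.fixedPoint T hcontr with hustar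
  have hfix : T ustar = ustar := ContractingWith.fixedPoint_isFixedPt (hf := hcontr)
  have hfix_t : ∀ t : ℝ, t ≤ 0 →
      ustar t = Real.exp t * ∫ s in (0 : ℝ)..t, (2 * ustar (s / 2) + f s) := by
    intro t ht
    have h1 : T ustar t = ustar t := by rw [hfix]
    rw [hT_apply, min_eq_left ht] at h1
    exact h1.symm
  -- the integrand and the solution
  set G : ℝ → ℝ := fun s => 2 * ustar (s / 2) + f s with hG_def
  have hGcont : Continuous G :=
    (continuous_const.mul (ustar.continuous.comp (continuous_id.div_const 2))).add hf
  set h : ℝ → ℝ := fun t => ∫ s in (0 : ℝ)..t, G s with hh_def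
  have hhcont : Continuous h :=
    intervalIntegral.continuous_primitive (fun a b => hGcont.intervalIntegrable a b) 0
  have hh0 : h 0 = 0 := by simp [hh_def]
  have hu_eq : ∀ t : ℝ, t ≤ 0 → ustar t = Real.exp t * h t := fun t ht => hfix_t t ht
  have hderiv : ∀ t : ℝ, HasDerivAt h (G t) t := fun t => (hGcont.integral_hasStrictDerivAt 0 t).hasDerivAt
  refine ⟨h, hhcont, hh0, fun t ht => ?_, ‖ustar‖, fun t ht => ?_⟩
  · have hG_t : G t = 2 * Real.exp (t / 2) * h (t / 2) + f t := by
      simp only [hG_def]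
      rw [hu_eq (t / 2) (by linarith)]
      ring
    rw [← hG_t]
    exact hderiv t
  · have h1 : h t = Real.exp (-t) * ustar t := by
      rw [hu_eq t ht, ← mul_assoc, ← Real.exp_add, neg_add_cancel, Real.exp_zero, one_mul]
    rw [h1, abs_mul, abs_of_pos (Real.exp_pos _), mul_comm]
    exact mul_le_mul_of_nonneg_right (by rw [← Real.norm_eq_abs]; exact ustar.norm_coe_le_norm t)
      (Real.exp_pos _).le

/-- **UNIQUENESS for the backward inhomogeneous pantograph problem**: two functions continuous on
`(−∞,0]`, solving `h' = 2e^{t/2}h(t/2) + f(t)` on `t < 0`, with the same value at `0`, agree on `(−∞,0]`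
(the difference solves the homogeneous equation with value `0` at `0⁻`:
`WakeRatchetRelayKernel.pantograph_eq_zero`).
[cite: Tao2016AveragedNS, §1.2 (dyadic model); cell vocabulary (programme R-lac, step R-lac-2)] -/
theorem pantograph_inhom_unique {h₁ h₂ : ℝ → ℝ} (hc₁ : ContinuousOn h₁ (Iic 0))
    (hc₂ : ContinuousOn h₂ (Iic 0))
    (hd₁ : ∀ t : ℝ, t < 0 → HasDerivAt h₁ (2 * Real.exp (t / 2) * h₁ (t / 2) + f t) t)
    (hd₂ : ∀ t : ℝ, t < 0 → HasDerivAt h₂ (2 * Real.exp (t / 2) * h₂ (t / 2) + f t) t)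
    (h0 : h₁ 0 = h₂ 0) : ∀ t : ℝ, t ≤ 0 → h₁ t = h₂ t := by
  have hc : ContinuousOn (fun t => h₁ t - h₂ t) (Iic 0) := hc₁.sub hc₂
  have hd : ∀ t : ℝ, t < 0 →
      HasDerivAt (fun t => h₁ t - h₂ t) (2 * Real.exp (t / 2) * (h₁ (t / 2) - h₂ (t / 2))) t := by
    intro t ht
    refine ((hd₁ t ht).sub (hd₂ t ht)).congr_deriv ?_
    ring
  intro t ht
  have := pantograph_eq_zero hc hd (by simp [h0]) t ht
  linarith

end WakeRatchetRelaySolvability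

end Summit.NavierStokesRegularity.NavierStokesRegularity.Theorems

end
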